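import Summits.RiemannHypothesis.RiemannHypothesis.Theorems.Splittings.BombieriTruncClump

/-!
# Splittings — x-wuc (xiv-d2): `B′([−1,1])` forces OFF-LINE SPARSITY; the partner BM_off, the cell Prop `SynthesisScreening` and rows X-6

Cell rh-split, seat rh-split-x-wuc g6/g7 (brief sha16 f79c5f09d8bcb036), card `run/shared/lean/pub/rh-split/cards/SPLIT-x-wuc.md`
§12–§13 (scratch of record `HOME/rh-split-x-wuc/SplitXWucG7b.lean` sha16 d0583c86bc2d8ec7: farm `lean check` rc 0 · 0 sorry · 0 warning,
standard axioms; referee replays: see the card).  Carved VERBATIM from that scratch by `HOME/rh-split-x-wuc/cut7/make_cut7.py`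
(cut (xiv-d), deltas listed in `cut7/CUT7.md`); sections as numbered there.
* G6.5 `offLine_sparse_of_boundedAway` (bounded clumps per unit ordinate window, per multiplicity cap); G6.6 `OffLineBoundedMult` (BM_off,
  `@[conjecture]`: open, RH-implied), `SynthesisScreening` (cell Prop; a THEOREM modulo Littlewood's gap fact, see
  `BombieriTruncSynthesisScreening.synthesisScreening_of`), rows `rh_iff_offLineBoundedMult_and_boundedAway (h5 : Corollary11Prov)
  (h6 : SynthesisScreening)`, X-6∨, X-6s.  [new-combination rows; CONDITIONAL bookkeeping]
HONEST LABEL: «SPLITTING SEARCH over kernel-typed RH-EQUIVALENCES; a splitting A ∧ B ⟹ RH is CONDITIONAL bookkeeping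
unless A and B are both proved; nothing here bears on the truth of RH.»
-/

set_option linter.dupNamespace false

noncomputable section

open scoped Classical ComplexConjugate
open Set Filter Topology Complex MeasureTheory

namespace Summit.RiemannHypothesis.RiemannHypothesis.Theorems.Splittings.BombieriTruncOffLineSparse

open Literature.NumberTheory.LFunctions Literature.NumberTheory.LFunctions.Bombieri2000
open Summit.RiemannHypothesis.RiemannHypothesis.Theses.RuelleBand
open Summit.RiemannHypothesis.RiemannHypothesis.Theorems.Splittings.BombieriTruncEigen
open Summit.RiemannHypothesis.RiemannHypothesis.Theorems.Splittings.BombieriFozNoDep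
open Summit.RiemannHypothesis.RiemannHypothesis.Theorems.Splittings.BombieriTruncGram
open Summit.RiemannHypothesis.RiemannHypothesis.Theorems.Splittings.BombieriTruncPairing
open Summit.RiemannHypothesis.RiemannHypothesis.Theorems.Splittings.BombieriTruncScreening
open Summit.RiemannHypothesis.RiemannHypothesis.Theorems.Splittings.BombieriTruncBandGap
open Summit.RiemannHypothesis.RiemannHypothesis.Theorems.Splittings.BombieriTruncMultiplicity
open Summit.RiemannHypothesis.RiemannHypothesis.Theorems.Splittings.BombieriTruncEventualStrip
open Summit.RiemannHypothesis.RiemannHypothesis.Theorems.Splittings.BombieriTruncExactness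
open Summit.RiemannHypothesis.RiemannHypothesis.Theorems.Splittings.BombieriTruncClump

variable {N : ℕ}

/-! ### G6.5 `B′([−1,1])` forces OFF-LINE SPARSITY -/

/-- Crude bound `tailConst d ≤ 2/d` for `d ≥ 1`. -/
theorem tailConst_le {d : ℕ} (hd : 0 < d) : tailConst d ≤ 2 / (d : ℝ) := by
  unfold tailConst
  have hdR : (0 : ℝ) < d := by exact_mod_cast hd
  have hd1 : (1 : ℝ) ≤ d := by exact_mod_cast hd
  have hfact : (d : ℝ) ≤ (d.factorial : ℝ) := by exact_mod_cast Nat.self_le_factorial d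
  rw [← div_eq_mul_inv, div_le_div_iff₀ (by positivity) hdR]
  push_cast
  nlinarith [mul_le_mul_of_nonneg_left hfact hdR.le, hd1]

/-- For every multiplicity cap `M` and every `c > 0` some clump size `d+1` makes the constant of `clump_negRoot` smaller than `c`. -/
theorem exists_clump_size (M : ℕ) {c : ℝ} (hc : 0 < c) :
    ∃ d : ℕ, 0 < d ∧ 4 * ((d : ℝ) + 1) * M * tailConst d ^ 2 < c := by
  obtain ⟨d₀, hd₀⟩ := exists_nat_gt (32 * M / c)
  refine ⟨d₀ + 1, Nat.succ_pos d₀, ?_⟩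
  set d : ℕ := d₀ + 1 with hd
  have hdpos : 0 < d := Nat.succ_pos d₀
  have hdR : (0 : ℝ) < d := by exact_mod_cast hdpos
  have hd0 : (d : ℝ) ≠ 0 := hdR.ne'
  have hd1 : (1 : ℝ) ≤ d := by exact_mod_cast hdpos
  have hM0 : (0 : ℝ) ≤ M := Nat.cast_nonneg M
  have ht2 : tailConst d ^ 2 ≤ (2 / (d : ℝ)) ^ 2 := pow_le_pow_left₀ (tailConst_nonneg d) (tailConst_le hdpos) 2
  have h32 : 32 * (M : ℝ) < c * d := by
    have h1 : 32 * (M : ℝ) < d₀ * c := (div_lt_iff₀ hc).1 hd₀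
    have h2 : (d₀ : ℝ) ≤ d := by rw [hd]; push_cast; linarith
    nlinarith
  calc 4 * ((d : ℝ) + 1) * M * tailConst d ^ 2
      ≤ 4 * ((d : ℝ) + 1) * M * (2 / (d : ℝ)) ^ 2 := by gcongr
    _ ≤ 4 * (2 * (d : ℝ)) * M * (2 / (d : ℝ)) ^ 2 := by gcongr; linarith
    _ = 32 * (M : ℝ) / (d : ℝ) := by field_simp; ring
    _ < c := by rw [div_lt_iff₀ hdR]; exact h32

/-- **`B′([−1,1])` ⟹ BOUNDED OFF-LINE CLUMPS (slot level; kernel corollary of T6b′).**  If the negative real spectrum of Bombieri's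
truncations on `[−1,1]` is bounded away from `0`, then for every multiplicity cap `M` there are `D, N₀` such that at every level
`N ≥ N₀`, every set of slots carrying pairwise different zeros right of the line, of class multiplicity `≤ M`, inside a unit disc
`|ρ − ½ − i t₀| ≤ 1`, has AT MOST `D` elements.  (Unconditional implication; no simplicity, no named fact.) [new] -/
theorem clump_card_le_of_boundedAway (hB : TruncNegEigenvalueBoundedAway (Icc (-1 : ℝ) 1)) (M : ℕ) :
    ∃ D N₀ : ℕ, ∀ N, N₀ ≤ N → ∀ (t₀ : ℝ) (S : Finset (truncIdx N)),
      (∀ j ∈ S, 1 / 2 < (j : ZeroIdx).val.re) →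
      (∀ j ∈ S, ∀ l ∈ S, (j : ZeroIdx).val = (l : ZeroIdx).val → j = l) →
      (∀ j ∈ S, (fib j).card ≤ M) →
      (∀ j ∈ S, ‖(j : ZeroIdx).val - 1 / 2 - I * t₀‖ ≤ 1) → S.card ≤ D := by
  obtain ⟨c, hc, N₀, hN₀⟩ := hB
  obtain ⟨d, hdpos, hdc⟩ := exists_clump_size M hc
  refine ⟨d, N₀, fun N hN t₀ S hre hinj hM hw ↦ ?_⟩
  by_contra hlt
  obtain ⟨S', hS'S, hS'card⟩ := Finset.exists_subset_card_eq (show d + 1 ≤ S.card by omega)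
  have hconst : 4 * (S'.card : ℝ) * M * tailConst d ^ 2 < c := by
    rw [hS'card, Nat.cast_add_one]
    exact hdc
  obtain ⟨μ, hμ, him, hlo, hneg⟩ := clump_negRoot (N := N) hdpos (by omega) t₀
    (fun j hj ↦ hre j (hS'S hj)) (fun j hj l hl h ↦ hinj j (hS'S hj) l (hS'S hl) h)
    (fun j hj ↦ hM j (hS'S hj)) (fun j hj ↦ hw j (hS'S hj)) hconst
  have := hN₀ N hN μ hμ him hneg
  linarith

/-- **`B′([−1,1])` ⟹ OFF-LINE SPARSITY (zero level).**  For every multiplicity cap `M` there is `D` such that every finite set of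
non-trivial zeros RIGHT of the critical line, of multiplicity `≤ M`, with ordinates in a window `|Im ρ − t₀| ≤ ½`, has at most `D`
elements.  Contrapositive: `M`-bounded off-line zeros CLUSTERING without bound in unit ordinate windows refute `B′([−1,1])`. [new] -/
theorem offLine_sparse_of_boundedAway (hB : TruncNegEigenvalueBoundedAway (Icc (-1 : ℝ) 1)) (M : ℕ) :
    ∃ D : ℕ, ∀ (t₀ : ℝ) (T : Finset ℂ),
      (∀ ρ ∈ T, ρ ∈ ZetaZeros.riemannZetaNontrivialZeros ∧ 1 / 2 < ρ.re ∧
        riemannZetaZeroOrder ρ ≤ M ∧ |ρ.im - t₀| ≤ 1 / 2) → T.card ≤ D := by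
  obtain ⟨D, N₀, hD⟩ := clump_card_le_of_boundedAway hB M
  refine ⟨D, fun t₀ T hT ↦ ?_⟩
  -- a slot for every zero of `T`
  have hslot : ∀ ρ : T, ∃ i : ZeroIdx, i.val = (ρ : ℂ) := fun ρ ↦ exists_slot (hT ρ ρ.2).1
  choose g hg using hslot
  -- a level containing all of them
  set N : ℕ := max N₀ (T.sup fun ρ ↦ ⌈‖ρ - 1 / 2‖⌉₊) with hN
  have hmem : ∀ ρ : T, g ρ ∈ truncIdx N := by
    intro ρ
    apply mem_truncIdx_of_le
    rw [hg ρ]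
    calc ‖(ρ : ℂ) - 1 / 2‖ ≤ ⌈‖(ρ : ℂ) - 1 / 2‖⌉₊ := Nat.le_ceil _
      _ ≤ ((T.sup fun ρ ↦ ⌈‖ρ - 1 / 2‖⌉₊ : ℕ) : ℝ) := by
          exact_mod_cast Finset.le_sup (f := fun ρ : ℂ ↦ ⌈‖ρ - 1 / 2‖⌉₊) ρ.2
      _ ≤ N := by exact_mod_cast le_max_right _ _
  set f : T → truncIdx N := fun ρ ↦ ⟨g ρ, hmem ρ⟩ with hf
  have hfval : ∀ ρ : T, ((f ρ : truncIdx N) : ZeroIdx).val = (ρ : ℂ) := fun ρ ↦ hg ρ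
  have hfinj : Function.Injective f := by
    intro ρ ρ' h
    apply Subtype.ext
    rw [← hfval ρ, ← hfval ρ', h]
  set S : Finset (truncIdx N) := Finset.univ.image f with hS
  have hcard : S.card = T.card := by
    rw [hS, Finset.card_image_of_injective _ hfinj, Finset.card_univ, Fintype.card_coe]
  have hS_mem : ∀ j ∈ S, ∃ ρ : T, f ρ = j := fun j hj ↦ by
    simpa [hS] using hj
  rw [← hcard]
  refine hD N (le_max_left _ _) t₀ S (fun j hj ↦ ?_) (fun j hj l hl h ↦ ?_) (fun j hj ↦ ?_) (fun j hj ↦ ?_)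
  · obtain ⟨ρ, rfl⟩ := hS_mem j hj
    rw [hfval]
    exact (hT ρ ρ.2).2.1
  · obtain ⟨ρ, rfl⟩ := hS_mem j hj
    obtain ⟨ρ', rfl⟩ := hS_mem l hl
    rw [hfval, hfval] at h
    rw [Subtype.ext h]
  · obtain ⟨ρ, rfl⟩ := hS_mem j hj
    have h1 := card_fib_le_order (f ρ)
    rw [hfval] at h1
    have h2 : (riemannZetaZeroOrder (ρ : ℂ) : ℝ) ≤ M := by exact_mod_cast (hT ρ ρ.2).2.2.1
    exact_mod_cast h1.trans h2
  · obtain ⟨ρ, rfl⟩ := hS_mem j hj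
    rw [hfval]
    have hρ := hT ρ ρ.2
    have hlt1 := (mem_riemannZetaNontrivialZeros_iff_holds.1 hρ.1).2.2
    have hre : |(ρ : ℂ).re - 1 / 2| ≤ 1 / 2 := abs_le.2 ⟨by linarith [hρ.2.1], by linarith⟩
    calc ‖(ρ : ℂ) - 1 / 2 - I * t₀‖ ≤ |((ρ : ℂ) - 1 / 2 - I * t₀).re| + |((ρ : ℂ) - 1 / 2 - I * t₀).im| :=
          Complex.norm_le_abs_re_add_abs_im _
      _ = |(ρ : ℂ).re - 1 / 2| + |(ρ : ℂ).im - t₀| := by simp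
      _ ≤ 1 / 2 + 1 / 2 := add_le_add hre hρ.2.2.2
      _ = 1 := by norm_num

/-! ### G6.6 The typed partner BM_off, the cell Prop X-6 and the bookkeeping rows -/

/-- **BM_off — bounded off-line multiplicity** (partner `A₆` of row X-6): the multiplicities of the non-trivial zeros OFF the
critical line are bounded.  RH-implied (vacuously), implied by the simplicity conjecture, OPEN; says nothing about LOCATION. -/
@[conjecture] def OffLineBoundedMult : Prop :=
  ∃ M : ℕ, ∀ ρ ∈ ZetaZeros.riemannZetaNontrivialZeros, ρ.re ≠ 1 / 2 → riemannZetaZeroOrder ρ ≤ M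

/-- RH ⟹ BM_off (vacuously: there are no off-line zeros). -/
theorem offLineBoundedMult_of_rh (hRH : _root_.RiemannHypothesis) : OffLineBoundedMult :=
  ⟨0, fun _ hρ hre ↦ absurd (re_eq_half_of_rh hRH hρ) hre⟩

/-- FOZ ⟹ BM_off (finitely many off-line zeros have bounded multiplicity). -/
theorem offLineBoundedMult_of_foz (h : CofiniteCriticalLine) : OffLineBoundedMult := by
  have hfin := cofiniteCriticalLine_iff_foz.1 h
  refine ⟨hfin.toFinset.sup fun ρ ↦ (riemannZetaZeroOrder ρ).toNat, fun ρ hρ hre ↦ ?_⟩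
  have hmem : ρ ∈ hfin.toFinset := hfin.mem_toFinset.2 ⟨hρ, hre⟩
  have h1 : (riemannZetaZeroOrder ρ).toNat ≤ hfin.toFinset.sup fun ρ ↦ (riemannZetaZeroOrder ρ).toNat :=
    Finset.le_sup (f := fun ρ ↦ (riemannZetaZeroOrder ρ).toNat) hmem
  have h2 : riemannZetaZeroOrder ρ ≤ ((riemannZetaZeroOrder ρ).toNat : ℤ) := Int.self_le_toNat _
  omega

/-- «All OFF-LINE zeros are simple» (a fragment of the simplicity conjecture SZC) ⟹ BM_off. -/
theorem offLineBoundedMult_of_offLineSimple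
    (h : ∀ ρ ∈ ZetaZeros.riemannZetaNontrivialZeros, ρ.re ≠ 1 / 2 → riemannZetaZeroOrder ρ ≤ 1) :
    OffLineBoundedMult := ⟨1, fun ρ hρ hre ↦ by exact_mod_cast h ρ hρ hre⟩

/-- **X-6 (PAPER theorem of the card §12.3, NOT kernel, NOT in print)** as a named cell Prop: under bounded off-line multiplicity,
infinitely many off-line zeros refute Bombieri's `B′([−1,1])`.  Its proof in the card is the DICHOTOMY «Littlewood gap theorem ⟹
either a Kadec-¼ near-lattice of on-line ordinates around the off-line target (T6a: Kadec/Duffin–Eachus Riesz-basis synthesis +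
compactness of the Kadec class) or a clump of `≥ d+1` off-line zeros in a window of length `≤ 1` (T6b′ = `clump_negRoot`)». -/
def SynthesisScreening : Prop :=
  OffLineBoundedMult → ¬ CofiniteCriticalLine → ¬ TruncNegEigenvalueBoundedAway (Icc (-1 : ℝ) 1)

open Summit.RiemannHypothesis.RiemannHypothesis.Theorems.Splittings.BombieriCorollaryProvenance in
/-- **Row X-6 (bookkeeping, modulo the named fact `Corollary11Prov` = row C5 and the paper theorem X-6):**
`RH ⟺ BM_off ∧ B′([−1,1])`.  [new-combination; CONDITIONAL bookkeeping] -/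
theorem rh_iff_offLineBoundedMult_and_boundedAway (h5 : Corollary11Prov) (h6 : SynthesisScreening) :
    _root_.RiemannHypothesis ↔ OffLineBoundedMult ∧ TruncNegEigenvalueBoundedAway (Icc (-1 : ℝ) 1) := by
  refine ⟨fun hRH ↦ ⟨offLineBoundedMult_of_rh hRH, truncNegEigenvalueBoundedAway_Icc_of_rh hRH 1⟩, fun h ↦ ?_⟩
  by_cases hfoz : CofiniteCriticalLine
  · exact (rh_iff_foz_and_boundedAway_one h5).2 ⟨hfoz, h.2⟩
  · exact absurd h.2 (h6 h.1 hfoz)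

open Summit.RiemannHypothesis.RiemannHypothesis.Theorems.Splittings.BombieriCorollaryProvenance in
/-- **Row X-6∨:** `RH ⟺ (ES_m ∨ BM_off) ∧ B′([−1,1])` modulo the same two named hypotheses — the location partner of X-5 and the
multiplicity partner of X-6 are INTERCHANGEABLE heads. [new-combination; CONDITIONAL bookkeeping] -/
theorem rh_iff_esm_or_obm_and_boundedAway (h5 : Corollary11Prov) (h6 : SynthesisScreening) :
    _root_.RiemannHypothesis ↔
      (EventualStripMult ∨ OffLineBoundedMult) ∧ TruncNegEigenvalueBoundedAway (Icc (-1 : ℝ) 1) := by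
  refine ⟨fun hRH ↦ ⟨Or.inr (offLineBoundedMult_of_rh hRH), truncNegEigenvalueBoundedAway_Icc_of_rh hRH 1⟩,
    fun h ↦ ?_⟩
  rcases h.1 with hES | hBM
  · exact (rh_iff_eventualStripMult_and_boundedAway_prov h5).2 ⟨hES, h.2⟩
  · exact (rh_iff_offLineBoundedMult_and_boundedAway h5 h6).2 ⟨hBM, h.2⟩

open Summit.RiemannHypothesis.RiemannHypothesis.Theorems.Splittings.BombieriCorollaryProvenance in
/-- **Row X-6s (the `A → (B ↔ RH)` reading):** GIVEN simple (indeed `M`-bounded) OFF-LINE zeros, Bombieri's question on `[−1,1]`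
and RH COINCIDE modulo the two named hypotheses — the ES_m conjunct of X-5 / X-5s is then DECORATION. [new-combination] -/
theorem boundedAway_one_iff_rh_of_offLineBoundedMult (h5 : Corollary11Prov) (h6 : SynthesisScreening)
    (hBM : OffLineBoundedMult) :
    TruncNegEigenvalueBoundedAway (Icc (-1 : ℝ) 1) ↔ _root_.RiemannHypothesis :=
  ⟨fun hB ↦ (rh_iff_offLineBoundedMult_and_boundedAway h5 h6).2 ⟨hBM, hB⟩,
    fun hRH ↦ truncNegEigenvalueBoundedAway_Icc_of_rh hRH 1⟩

/-- The kernel part of X-6 in words the card uses: `B′([−1,1])` and `M`-bounded off-line multiplicity leave only SPARSE off-line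
configurations (≤ `D(M)` zeros per unit ordinate window right of the line) — restated from `offLine_sparse_of_boundedAway`. -/
theorem offLine_sparse_of_boundedAway_of_obm (hB : TruncNegEigenvalueBoundedAway (Icc (-1 : ℝ) 1))
    (hBM : OffLineBoundedMult) :
    ∃ D : ℕ, ∀ (t₀ : ℝ) (T : Finset ℂ),
      (∀ ρ ∈ T, ρ ∈ ZetaZeros.riemannZetaNontrivialZeros ∧ 1 / 2 < ρ.re ∧ |ρ.im - t₀| ≤ 1 / 2) → T.card ≤ D := by
  obtain ⟨M, hM⟩ := hBM
  obtain ⟨D, hD⟩ := offLine_sparse_of_boundedAway hB M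
  exact ⟨D, fun t₀ T hT ↦ hD t₀ T fun ρ hρ ↦
    ⟨(hT ρ hρ).1, (hT ρ hρ).2.1, hM ρ (hT ρ hρ).1 (hT ρ hρ).2.1.ne', (hT ρ hρ).2.2⟩⟩

end Summit.RiemannHypothesis.RiemannHypothesis.Theorems.Splittings.BombieriTruncOffLineSparse
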